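/-
Copyright: cell `pub-ymgap` (HUMAN RULING D-0062), Track A of `YM-PLAN.md`, DAG node N20 (= NE7b); R134 acceleration seat
`pub-ymgap-dag-n20-c` (strategy s1, generation 3), module 10c.  Released under the licence of the surrounding project.
-/
import Summits.QuantumFields.YangMills.Theorems.BalabanUVNodesN20LCSRestrictedDoublingLower
import Mathlib.MeasureTheory.Integral.MeanInequalities
import HarnessLib

/-!
# YM-DAG node N20 (= NE7b), strategy s1, module 10c: RESTRICTED UNIFORM DOUBLING — the small-field-RESTRICTED Wilson partition function
# of every four-torus doubles uniformly in the volume, `Z_{L,ε}(b∕2) ≤ e^{A L⁴}·Z_{L,ε}(b)` for `b ≥ 4`, `bε ≥ c`, and the restricted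
# state's exponential moment of the action at the fraction `a ≤ ½` of the coupling is `≤ e^{2aA L⁴}` (located residual (ii)(c) of the
# seat's triage: the β-UNIFORM global input of a chessboard ∕ local-moment bound in the history term's own, restricted, state)

Track A of `YM-PLAN.md` (cell `pub-ymgap`, HUMAN RULING D-0062), node **N20** = spine estimate NE7b (`T4WeightBudget.RelWeightBound` — the
cell `pub-balaban`'s OWN estimate, NOT PRINTED in [Bałaban 1983–89], NOT PROVED).  Seat `pub-ymgap-dag-n20-c` (R134, s1), module 10 in three
files (10a `…N20LCSRestrictedDoublingOneSite`, 10b `…N20LCSRestrictedDoublingLower`, 10c `…N20LCSRestrictedDoubling`; modules 8∕9: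
`…Theorems.BalabanUVNodesN20LCSRestrictedRP{,CauchySchwarz}` — reflection positivity and reflection Cauchy–Schwarz of the restricted level-0
state).  Kernel theorems only: 0 `def`, 0 `sorry`, standard axioms; COUNT-NEUTRAL; `--supports` the K3′ item `SpineGivenEndpointR12`
(stmt-QuantumFields-19908) as a helper.  Nothing of Bałaban's is asserted: the objects are the host tree's (`partitionFunction`, `wilsonAction`,
`WilsonRP.plaqRe`, `haarProbability`, the comb gauge `combEdges`∕`combHolonomy`, the hyperplane twist of `TwistLower`), read BY NAME; the
small-field-RESTRICTED partition function `Z_{L,ε}(b) := ∫ e^{−b S(U)}·∏_p 𝟙[N − Re tr r(U_p) ≤ ε] dHaar^{⊗E}(U)` is written INLINE (no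
definition is introduced).

WHY (the three files).  «LCS-j» (`Spine/NE7b/LocalConditionalStability.LocCondStability`) from level 1 on asks local exponential plaquette
moments in the HISTORY TERM's own state, i.e. for the Wilson weight RESTRICTED by the earlier steps' small-field characteristic functions
(modules 1∕6∕7; the seat's `N20-S1-TRIAGE.md` §1, residual (ii)).  The unrestricted rung 0 (`Spine/NE7b/LocalPlaquetteExpMoments`) is
chessboard + convexity + the host's UNIFORM TORUS DOUBLING `Z_L(b∕2) ≤ e^{AL⁴}Z_L(b)` (`TorusGauge.uniformDoubling_all`); for the restricted
state the chessboard inputs are modules 8∕9 and the β-uniform global input is the RESTRICTED doubling `Z_{L,ε}(b∕2) ≤ e^{AL⁴}Z_{L,ε}(b)`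
(`bε ≥ c`) of file 10c.  No monotonicity in the restriction is available in the tree (no FKG for gauge theories), so the β-uniform comparison
must come from the Gaussian localisation itself: the host's lower-bound region (comb gauge, inner links in `δ = b^{−1∕2}`-balls around the
hyperplane twist of the four axis holonomies) lies INSIDE the `ε`-small region as soon as the axis holonomies' six commutator energies are
`≤ ε' = (ε − 16∕b)∕2`, which costs at most a factor `2` of the one-site function once `bε ≥ c(r)`.

WHAT IS PROVED HERE ([folklore]: logarithmic bookkeeping, Hölder; files 10a∕10b and the host's upper half BY NAME):
* §5 ★★ **`restricted_uniformDoubling`** — `∃ A c, 0 < c ∧ ∀ L ≥ 2, b ≥ 4, bε ≥ c: Z_{L,ε}(b∕2) ≤ e^{AL⁴}·Z_{L,ε}(b)`: the restricted twin of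
  the host's `TorusGauge.uniformDoubling_all`; the upper half is FREE (`Z_{L,ε} ≤ Z_L`, `torus_upper_axisHolonomy`, the iterated one-site
  doubling `partitionFunction_iterate_quarter` across the temperature mismatch `8L⁴ ≤ 4^{2L+2}`, `partitionFunction_antitone`), the lower half is
  file 10b's `restricted_torus_lower_axisHolonomy`, and the `log b` terms cancel exactly (`doubling_bookkeeping_all`).
* §6 ★ **`restricted_actionMoment_le`** — `∫ e^{abS}·e^{−bS}∏_p 𝟙[N − Re tr r(U_p) ≤ ε] dHaar ≤ e^{2aAL⁴}·Z_{L,ε}(b)` for `0 ≤ a ≤ ½`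
  (`L ≥ 2`, `b ≥ 4`, `bε ≥ c`): Hölder interpolation (`ENNReal.lintegral_mul_le_Lp_mul_Lq`, exponents `1∕(2a)`, `1∕(1−2a)`) between `a = 0`
  and the doubling at `a = ½` — the restricted twin of `LocalPlaquetteExpMoments.integral_exp_class_le_exp`, i.e. the GLOBAL input
  `ψ(univ) ≤ e^{2aAL⁴}` of a chessboard estimate for the restricted state.

HONEST FRAMING.  Host currency (bare Wilson weight on `GaugeConfig 4 L G`, any compact second-countable `G` with a faithful unitary
`LatticeRep`), ONE threshold `ε` on ALL plaquettes, `bε ≥ c(r)` (Bałaban's small-field thresholds have `βε_k → ∞`, so the hypothesis is the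
regime; for `bε < c` nothing is claimed).  NOT here: the site∕cube chessboard ITERATION for the restricted state (residual (ii)(b)), the
record-level reading (module 7's dictionary transports it), levels `≥ 1` of LCS, residual (i) (domination letter for `avOfRecord`, seat
n20-d), (iv) (A1c).  NE7b NOT PRINTED ∕ NOT PROVED; (α)-instance 0∕1; N20 NOT discharged; typed 28∕28, discharged count untouched; one finite
four-torus at fixed `ε` — NOT ℝ⁴, NOT infinite volume, NOT OS axioms, NOT a mass gap, NOT Clay.
-/

set_option autoImplicit false

noncomputable section

open scoped Matrix.Norms.Frobenius ENNReal
open MeasureTheory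
open Literature.MathematicalPhysics.QuantumFieldTheory
open Summit.QuantumFields.YangMills.Theorems.FreeEnergyLogCoefficient (dimE exists_haar_gball_ge WeakCoupling.sub_re_trace_eq
  haar_setOf_norm_sub_le continuous_norm_rho_sub)
open Summit.QuantumFields.YangMills.Theorems.FemtoCurvatureTwoPoint.DoublingOfRV (card_plaquette)
open Summit.QuantumFields.YangMills.Theorems.FemtoCurvatureTwoPoint.PlaquetteVariance (partitionFunction_toReal_pos)
open Summit.QuantumFields.YangMills.Theorems.FemtoCurvatureTwoPointC (OneSite.partitionFunction_eq_lintegral'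
  OneSite.plaquetteHolonomy_eq_commutator OneSite.wilsonAction_eq_commutatorCost oneSite_partitionFunction_doubling)
open Summit.QuantumFields.YangMills.Theorems.FemtoCurvatureTwoPointC.TorusGauge

namespace Summit.QuantumFields.YangMills.BalabanUVNodes.N20LCSRestrictedDoubling

/-! ## §5 (continued) The RESTRICTED UNIFORM DOUBLING on all boxes -/

section Doubling

variable {G : Type} [Group G] [TopologicalSpace G] [IsTopologicalGroup G] [CompactSpace G] [MeasurableSpace G]
  [BorelSpace G] [SecondCountableTopology G]

/-- **RESTRICTED UNIFORM DOUBLING ON ALL BOXES.**  For a compact second-countable group `G` with a faithful continuous unitary lattice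
representation `r` there are ONE `A` and ONE `c > 0` such that the small-field-RESTRICTED Wilson partition function
`Z_{L,ε}(b) = ∫ e^{−bS(U)}·∏_p 𝟙[N − Re tr r(U_p) ≤ ε] dHaar^{⊗E}(U)` of EVERY four-torus `(ℤ∕L)⁴`, `L ≥ 2`, satisfies

  `Z_{L,ε}(b∕2) ≤ e^{A L⁴} · Z_{L,ε}(b)`   for every `b ≥ 4` and every threshold `ε` with `bε ≥ c`

— the restricted twin of the host's `TorusGauge.uniformDoubling_all` (the β-uniform input of an exponential-moment∕chessboard bound in a
small-field-restricted state).  Proof: the upper half is FREE (`Z_{L,ε} ≤ Z_L` and the host's conditioned upper bound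
`torus_upper_axisHolonomy`, the iterated one-site doubling `partitionFunction_iterate_quarter` across the temperature mismatch
`8L⁴ ≤ 4^{2L+2}`, `partitionFunction_antitone`); the lower half is `restricted_torus_lower_axisHolonomy`; the `log b` terms cancel exactly
as in the host's bookkeeping `doubling_bookkeeping_all`.  Honest scope: a statement about the bare Wilson weight restricted by the
ALL-plaquette small-field characteristic function of ONE threshold on a finite four-torus; nothing of Bałaban's is asserted. [folklore] -/
theorem restricted_uniformDoubling (r : LatticeRep G) :
    ∃ A c : ℝ, 0 < c ∧ ∀ (L : ℕ) [NeZero L] (b ε : ℝ), 2 ≤ L → 4 ≤ b → c ≤ b * ε →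
      (∫⁻ U : GaugeConfig 4 L G, ENNReal.ofReal (Real.exp (-(b / 2) * wilsonAction r.ρ U) *
          ∏ p : Plaquette 4 L, (if (r.N : ℝ) - WilsonRP.plaqRe r.ρ U p ≤ ε then (1 : ℝ) else 0))
        ∂(Measure.pi fun _ : Edge 4 L => haarProbability G)).toReal ≤
        Real.exp (A * (L : ℝ) ^ 4) *
          (∫⁻ U : GaugeConfig 4 L G, ENNReal.ofReal (Real.exp (-b * wilsonAction r.ρ U) *
              ∏ p : Plaquette 4 L, (if (r.N : ℝ) - WilsonRP.plaqRe r.ρ U p ≤ ε then (1 : ℝ) else 0))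
            ∂(Measure.pi fun _ : Edge 4 L => haarProbability G)).toReal := by
  obtain ⟨C, hC, hup⟩ := torus_upper_axisHolonomy r
  obtain ⟨C₁, A₀, c, hC₁, hc, hlow⟩ := restricted_torus_lower_axisHolonomy r
  obtain ⟨K₀, hK₀⟩ := oneSite_partitionFunction_doubling G r
  -- WLOG `K ≥ 1`
  set K : ℝ := max K₀ 1 with hKdef
  have hK1 : 1 ≤ K := le_max_right _ _
  have hK0 : 0 ≤ K := zero_le_one.trans hK1
  have hKd : ∀ t : ℝ, 0 < t → (partitionFunction (d := 4) (L := 1) r.ρ (t / 4)).toReal ≤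
      K * (partitionFunction (d := 4) (L := 1) r.ρ t).toReal := fun t ht =>
    (hK₀ t ht).trans (mul_le_mul_of_nonneg_right (le_max_left _ _) ENNReal.toReal_nonneg)
  -- the constant
  set q : ℝ := Real.log C - Real.log C₁ + (dimE r.ρ : ℝ) / 2 * Real.log 4 with hq
  refine ⟨3 * |q| + 3 * Real.log K + |A₀|, c, hc, fun L _ b ε hL hb hbε => ?_⟩
  have hb0 : 0 < b := by linarith
  have hb1 : 1 ≤ b := by linarith
  have hL1 : (1 : ℝ) ≤ L := by exact_mod_cast (show 1 ≤ L by omega)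
  have hL0 : (0 : ℝ) < L := by linarith
  have hL4 : (1 : ℝ) ≤ (L : ℝ) ^ 4 := one_le_pow₀ hL1
  -- the two temperatures of the one-site factor and their mismatch
  set s : ℝ := 2 * (L : ℝ) ^ 2 * b with hs
  set tu : ℝ := b / (4 * (L : ℝ) ^ 2) with htu
  have hs0 : 0 < s := by positivity
  have hmis : s / 4 ^ (2 * L + 2) ≤ tu := by
    rw [hs, htu, div_le_div_iff₀ (pow_pos (by norm_num) _) (by positivity)]
    have h8 := eight_mul_pow_four_le L
    nlinarith [h8, hb0, pow_nonneg hL0.le 2]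
  -- the restricted partition functions: notation, finiteness, positivity
  set Zh : ℝ := (∫⁻ U : GaugeConfig 4 L G, ENNReal.ofReal (Real.exp (-(b / 2) * wilsonAction r.ρ U) *
      ∏ p : Plaquette 4 L, (if (r.N : ℝ) - WilsonRP.plaqRe r.ρ U p ≤ ε then (1 : ℝ) else 0))
    ∂(Measure.pi fun _ : Edge 4 L => haarProbability G)).toReal with hZh_def
  set Zb : ℝ := (∫⁻ U : GaugeConfig 4 L G, ENNReal.ofReal (Real.exp (-b * wilsonAction r.ρ U) *
      ∏ p : Plaquette 4 L, (if (r.N : ℝ) - WilsonRP.plaqRe r.ρ U p ≤ ε then (1 : ℝ) else 0))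
    ∂(Measure.pi fun _ : Edge 4 L => haarProbability G)).toReal with hZb_def
  have hZfree := partitionFunction_toReal_pos (d := 4) (L := L) r.ρ r.continuous (b / 2)
  have hZh_le : Zh ≤ (partitionFunction (d := 4) (L := L) r.ρ (b / 2)).toReal :=
    ENNReal.toReal_mono (ENNReal.toReal_pos_iff.1 hZfree).2.ne (restrictedPF_le_partitionFunction r (b / 2) ε)
  have hZu := partitionFunction_toReal_pos (d := 4) (L := 1) r.ρ r.continuous tu
  have hZs := partitionFunction_toReal_pos (d := 4) (L := 1) r.ρ r.continuous s
  -- the cardinality `M = 3L⁴ − 3` as a real number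
  have hMle : 3 ≤ 3 * L ^ 4 := by
    have h4 : 0 < L ^ 4 := pow_pos (by omega) 4
    omega
  have hM : ((3 * L ^ 4 - 3 : ℕ) : ℝ) = 3 * (L : ℝ) ^ 4 - 3 := by
    rw [Nat.cast_sub hMle]
    push_cast
    ring
  -- the power laws and their logarithms
  have hx : 0 < (b / 4) ^ (-((dimE r.ρ : ℝ) / 2)) := Real.rpow_pos_of_pos (by linarith) _
  have hy : 0 < b ^ (-((dimE r.ρ : ℝ) / 2)) := Real.rpow_pos_of_pos hb0 _
  have hlogx : Real.log ((b / 4) ^ (-((dimE r.ρ : ℝ) / 2))) =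
      -((dimE r.ρ : ℝ) / 2) * (Real.log b - Real.log 4) := by
    rw [Real.log_rpow (by linarith), Real.log_div hb0.ne' (by norm_num)]
  have hlogy : Real.log (b ^ (-((dimE r.ρ : ℝ) / 2))) = -((dimE r.ρ : ℝ) / 2) * Real.log b :=
    Real.log_rpow hb0 _
  -- LOWER half at `b` (restricted), in logarithmic form; in particular `Zb > 0`
  have hpos : 0 < Real.exp (-(A₀ * (L : ℝ) ^ 4)) * (C₁ * b ^ (-((dimE r.ρ : ℝ) / 2))) ^ (3 * L ^ 4 - 3) *
      (partitionFunction (d := 4) (L := 1) r.ρ s).toReal :=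
    mul_pos (mul_pos (Real.exp_pos _) (pow_pos (mul_pos hC₁ hy) _)) hZs
  have hlowb := hlow L b ε hL hb1 hbε
  have hZb : 0 < Zb := hpos.trans_le hlowb
  have hLo : -(A₀ * (L : ℝ) ^ 4) + (3 * (L : ℝ) ^ 4 - 3) *
        (Real.log C₁ + -((dimE r.ρ : ℝ) / 2) * Real.log b) +
        Real.log (partitionFunction (d := 4) (L := 1) r.ρ s).toReal ≤ Real.log Zb := by
    have h := Real.log_le_log hpos hlowb
    rwa [Real.log_mul (mul_pos (Real.exp_pos _) (pow_pos (mul_pos hC₁ hy) _)).ne' hZs.ne',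
      Real.log_mul (Real.exp_pos _).ne' (pow_pos (mul_pos hC₁ hy) _).ne', Real.log_exp,
      Real.log_pow, Real.log_mul hC₁.ne' hy.ne', hlogy, hM] at h
  -- the trivial case `Zh = 0`, else logarithms
  rcases (ENNReal.toReal_nonneg : 0 ≤ Zh).eq_or_lt with hZh0 | hZh0
  · have hZ0 : Zh = 0 := hZh0.symm
    rw [hZ0]
    positivity
  -- UPPER half at `b` (free), in logarithmic form
  have hU : Real.log Zh ≤
      (3 * (L : ℝ) ^ 4 - 3) * (Real.log C + -((dimE r.ρ : ℝ) / 2) * (Real.log b - Real.log 4)) +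
        Real.log (partitionFunction (d := 4) (L := 1) r.ρ tu).toReal := by
    have h := Real.log_le_log hZh0 (hZh_le.trans (hup L b hL hb))
    rwa [Real.log_mul (pow_pos (mul_pos hC hx) _).ne' hZu.ne', Real.log_pow,
      Real.log_mul hC.ne' hx.ne', hlogx, hM] at h
  -- the one-site factor across the temperature mismatch
  have hO : Real.log (partitionFunction (d := 4) (L := 1) r.ρ tu).toReal ≤
      (2 * L + 2 : ℕ) * Real.log K + Real.log (partitionFunction (d := 4) (L := 1) r.ρ s).toReal := by
    have h1 : (partitionFunction (d := 4) (L := 1) r.ρ tu).toReal ≤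
        (partitionFunction (d := 4) (L := 1) r.ρ (s / 4 ^ (2 * L + 2))).toReal :=
      partitionFunction_antitone r hmis
    have h2 := partitionFunction_iterate_quarter r hK0 hKd (2 * L + 2) s hs0
    have hKm : 0 < K ^ (2 * L + 2) := pow_pos (by linarith) _
    have h := Real.log_le_log hZu (h1.trans h2)
    rwa [Real.log_mul hKm.ne' hZs.ne', Real.log_pow] at h
  -- bookkeeping: the `log b` terms cancel exactly
  have hkey : (3 * (L : ℝ) ^ 4 - 3) * (Real.log C + -((dimE r.ρ : ℝ) / 2) * (Real.log b - Real.log 4)) -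
      (3 * (L : ℝ) ^ 4 - 3) * (Real.log C₁ + -((dimE r.ρ : ℝ) / 2) * Real.log b) =
        (3 * (L : ℝ) ^ 4 - 3) * q := by
    rw [hq]; ring
  have hm : ((2 * L + 2 : ℕ) : ℝ) ≤ 3 * (L : ℝ) ^ 4 := by
    have hL2 : (2 : ℝ) ≤ L := by exact_mod_cast hL
    have h1 : (L : ℝ) ≤ (L : ℝ) ^ 4 := le_self_pow₀ hL1 (by norm_num)
    push_cast
    linarith
  have hbook := doubling_bookkeeping_all (q := q) (lK := Real.log K) (A₀ := A₀)
    (M := 3 * (L : ℝ) ^ 4 - 3) (m := ((2 * L + 2 : ℕ) : ℝ)) (L4 := (L : ℝ) ^ 4)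
    (by linarith) (by linarith) hm (Real.log_nonneg hK1) (by positivity)
  -- exponentiate
  rw [← Real.log_le_log_iff hZh0 (mul_pos (Real.exp_pos _) hZb), Real.log_mul (Real.exp_pos _).ne' hZb.ne', Real.log_exp]
  linarith [hU, hO, hLo, hkey, hbook]

/-! ## §6 The restricted GLOBAL exponential moment of the action: Hölder interpolation of the restricted doubling -/

/-- **THE RESTRICTED EXPONENTIAL MOMENT OF THE ACTION.**  With `A`, `c` as in `restricted_uniformDoubling` (enlarging `c`): for every
four-torus `L ≥ 2`, every `b ≥ 4`, every threshold with `bε ≥ c` and every `0 ≤ a ≤ ½`,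

  `∫ e^{abS}·e^{−bS}∏_p 𝟙[N − Re tr r(U_p) ≤ ε] dHaar ≤ e^{2aA L⁴} · ∫ e^{−bS}∏_p 𝟙[N − Re tr r(U_p) ≤ ε] dHaar`,

i.e. in the small-field-RESTRICTED Gibbs state at coupling `b` the exponential moment of the whole action at the fraction `a` of the
coupling is at most `e^{2aA L⁴}` — the global input `ψ(univ)` of a chessboard estimate for the restricted state (the host's
`LocalPlaquetteExpMoments.integral_exp_class_le_exp` is the unrestricted twin, there via convexity of `log Z`).  Proof: Hölder with
exponents `1∕(2a)`, `1∕(1 − 2a)` against the restricted weight (`ENNReal.lintegral_mul_le_Lp_mul_Lq`) interpolates between `a = 0` (equality)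
and `a = ½` (`restricted_uniformDoubling`): `Z_{L,ε}((1−a)b) ≤ Z_{L,ε}(b∕2)^{2a}·Z_{L,ε}(b)^{1−2a}`. [folklore] -/
theorem restricted_actionMoment_le (r : LatticeRep G) :
    ∃ A c : ℝ, 0 < c ∧ ∀ (L : ℕ) [NeZero L] (b ε a : ℝ), 2 ≤ L → 4 ≤ b → c ≤ b * ε → 0 ≤ a → a ≤ 1 / 2 →
      ∫⁻ U : GaugeConfig 4 L G, ENNReal.ofReal (Real.exp (a * b * wilsonAction r.ρ U) *
          (Real.exp (-b * wilsonAction r.ρ U) *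
            ∏ p : Plaquette 4 L, (if (r.N : ℝ) - WilsonRP.plaqRe r.ρ U p ≤ ε then (1 : ℝ) else 0)))
        ∂(Measure.pi fun _ : Edge 4 L => haarProbability G) ≤
      ENNReal.ofReal (Real.exp (2 * a * A * (L : ℝ) ^ 4)) *
        ∫⁻ U : GaugeConfig 4 L G, ENNReal.ofReal (Real.exp (-b * wilsonAction r.ρ U) *
            ∏ p : Plaquette 4 L, (if (r.N : ℝ) - WilsonRP.plaqRe r.ρ U p ≤ ε then (1 : ℝ) else 0))
          ∂(Measure.pi fun _ : Edge 4 L => haarProbability G) := by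
  obtain ⟨A, c, hc, hdbl⟩ := restricted_uniformDoubling r
  obtain ⟨C₁, A₀, c', hC₁, -, hlow⟩ := restricted_torus_lower_axisHolonomy r
  refine ⟨A, max c c', lt_max_of_lt_left hc, fun L _ b ε a hL hb hbε ha0 ha => ?_⟩
  have hcb : c ≤ b * ε := (le_max_left _ _).trans hbε
  have hc'b : c' ≤ b * ε := (le_max_right _ _).trans hbε
  have hb0 : 0 < b := by linarith
  set μ : Measure (GaugeConfig 4 L G) := Measure.pi fun _ : Edge 4 L => haarProbability G with hμ
  set D : GaugeConfig 4 L G → ℝ := fun U =>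
    ∏ p : Plaquette 4 L, (if (r.N : ℝ) - WilsonRP.plaqRe r.ρ U p ≤ ε then (1 : ℝ) else 0) with hD
  have hD0 : ∀ U, 0 ≤ D U := fun U => (smallField_nonneg_le_one r.ρ ε U).1
  set w : GaugeConfig 4 L G → ℝ≥0∞ := fun U => ENNReal.ofReal (Real.exp (-b * wilsonAction r.ρ U) * D U) with hw_def
  have hw : Measurable w := measurable_restrictedWeight r.ρ r.continuous b ε
  set Zb : ℝ≥0∞ := ∫⁻ U, w U ∂μ with hZb_def
  set Zh : ℝ≥0∞ := ∫⁻ U, ENNReal.ofReal (Real.exp (-(b / 2) * wilsonAction r.ρ U) * D U) ∂μ with hZh_def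
  have hZb_top : Zb ≠ ⊤ := restrictedPF_ne_top r b ε
  have hZh_top : Zh ≠ ⊤ := restrictedPF_ne_top r (b / 2) ε
  -- the doubling in extended form, and `Zb > 0` (restricted lower bound)
  have hdblE : Zh ≤ ENNReal.ofReal (Real.exp (A * (L : ℝ) ^ 4)) * Zb := by
    have h := hdbl L b ε hL hb hcb
    calc Zh = ENNReal.ofReal Zh.toReal := (ENNReal.ofReal_toReal hZh_top).symm
      _ ≤ ENNReal.ofReal (Real.exp (A * (L : ℝ) ^ 4) * Zb.toReal) := ENNReal.ofReal_le_ofReal h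
      _ = ENNReal.ofReal (Real.exp (A * (L : ℝ) ^ 4)) * Zb := by
          rw [ENNReal.ofReal_mul (Real.exp_pos _).le, ENNReal.ofReal_toReal hZb_top]
  have hZb_pos : Zb ≠ 0 := by
    intro h0
    have hl := hlow L b ε hL (by linarith) hc'b
    have hpos : 0 < Real.exp (-(A₀ * (L : ℝ) ^ 4)) * (C₁ * b ^ (-((dimE r.ρ : ℝ) / 2))) ^ (3 * L ^ 4 - 3) *
        (partitionFunction (d := 4) (L := 1) r.ρ (2 * (L : ℝ) ^ 2 * b)).toReal :=
      mul_pos (mul_pos (Real.exp_pos _) (pow_pos (mul_pos hC₁ (Real.rpow_pos_of_pos hb0 _)) _))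
        (partitionFunction_toReal_pos (d := 4) (L := 1) r.ρ r.continuous _)
    have hz : Zb.toReal = 0 := by rw [h0, ENNReal.toReal_zero]
    linarith [hl.trans_eq hz]
  -- the endpoint `a = 0`
  rcases ha0.eq_or_lt with rfl | ha0'
  · simp only [zero_mul, Real.exp_zero, one_mul, mul_zero, ENNReal.ofReal_one]
    exact le_rfl
  -- the endpoint `a = ½`
  rcases ha.eq_or_lt with rfl | ha'
  · have hpt : ∀ U : GaugeConfig 4 L G, Real.exp (1 / 2 * b * wilsonAction r.ρ U) *
        (Real.exp (-b * wilsonAction r.ρ U) * D U) = Real.exp (-(b / 2) * wilsonAction r.ρ U) * D U := by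
      intro U
      rw [← mul_assoc, ← Real.exp_add]
      congr 1
      ring_nf
    show ∫⁻ U, ENNReal.ofReal (Real.exp (1 / 2 * b * wilsonAction r.ρ U) *
        (Real.exp (-b * wilsonAction r.ρ U) * D U)) ∂μ ≤ ENNReal.ofReal (Real.exp (2 * (1 / 2) * A * (L : ℝ) ^ 4)) * Zb
    simp_rw [hpt]
    calc Zh ≤ ENNReal.ofReal (Real.exp (A * (L : ℝ) ^ 4)) * Zb := hdblE
      _ = ENNReal.ofReal (Real.exp (2 * (1 / 2) * A * (L : ℝ) ^ 4)) * Zb := by norm_num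
  -- the interior `0 < a < ½`: Hölder against `ν = w·μ` with exponents `p = 1/(2a)`, `q = 1/(1 − 2a)`
  set p : ℝ := 1 / (2 * a) with hp_def
  set q' : ℝ := 1 / (1 - 2 * a) with hq_def
  have h2a : 0 < 2 * a := by linarith
  have h2a' : 0 < 1 - 2 * a := by linarith
  have hp0 : 0 ≤ p := by positivity
  have hpq : p.HolderConjugate q' := by
    rw [Real.holderConjugate_iff]
    refine ⟨?_, ?_⟩
    · rw [hp_def, lt_div_iff₀ h2a]; linarith
    · rw [hp_def, hq_def]; field_simp; ring
  set ν : Measure (GaugeConfig 4 L G) := μ.withDensity w with hν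
  set f : GaugeConfig 4 L G → ℝ≥0∞ := fun U => ENNReal.ofReal (Real.exp (a * b * wilsonAction r.ρ U)) with hf_def
  set g : GaugeConfig 4 L G → ℝ≥0∞ := fun _ => 1 with hg_def
  have hf : Measurable f := ENNReal.measurable_ofReal.comp
    (Real.measurable_exp.comp ((WilsonRP.measurable_wilsonAction r.ρ r.continuous).const_mul _))
  have hg : Measurable g := measurable_const
  have hH := ENNReal.lintegral_mul_le_Lp_mul_Lq ν hpq hf.aemeasurable hg.aemeasurable
  -- the three integrals
  have h1 : ∫⁻ U, (f * g) U ∂ν =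
      ∫⁻ U, ENNReal.ofReal (Real.exp (a * b * wilsonAction r.ρ U) *
        (Real.exp (-b * wilsonAction r.ρ U) * D U)) ∂μ := by
    rw [hν, lintegral_withDensity_eq_lintegral_mul μ hw (hf.mul hg)]
    refine lintegral_congr fun U => ?_
    show w U * (f U * 1) = _
    rw [mul_one, ENNReal.ofReal_mul (Real.exp_pos _).le, mul_comm]
  have h2 : ∫⁻ U, f U ^ p ∂ν = Zh := by
    rw [hν, lintegral_withDensity_eq_lintegral_mul μ hw (hf.pow_const p)]
    refine lintegral_congr fun U => ?_
    show w U * f U ^ p = ENNReal.ofReal (Real.exp (-(b / 2) * wilsonAction r.ρ U) * D U)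
    have hab : a * b * wilsonAction r.ρ U * p = b / 2 * wilsonAction r.ρ U := by
      rw [hp_def]; field_simp
    rw [hf_def, ENNReal.ofReal_rpow_of_nonneg (Real.exp_pos _).le hp0, ← Real.exp_mul, hw_def,
      ← ENNReal.ofReal_mul (mul_nonneg (Real.exp_pos _).le (hD0 U)), hab, mul_right_comm, ← Real.exp_add,
      show -b * wilsonAction r.ρ U + b / 2 * wilsonAction r.ρ U = -(b / 2) * wilsonAction r.ρ U by ring]
  have h3 : ∫⁻ U, g U ^ q' ∂ν = Zb := by
    simp only [hg_def, ENNReal.one_rpow]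
    rw [lintegral_const, one_mul, hν, withDensity_apply _ MeasurableSet.univ, Measure.restrict_univ]
  have hinvp : 1 / p = 2 * a := by rw [hp_def, one_div_one_div]
  have hinvq : 1 / q' = 1 - 2 * a := by rw [hq_def, one_div_one_div]
  rw [h1, h2, h3, hinvp, hinvq] at hH
  -- combine with the doubling
  calc ∫⁻ U, ENNReal.ofReal (Real.exp (a * b * wilsonAction r.ρ U) *
          (Real.exp (-b * wilsonAction r.ρ U) * D U)) ∂μ
      ≤ Zh ^ (2 * a) * Zb ^ (1 - 2 * a) := hH
    _ ≤ (ENNReal.ofReal (Real.exp (A * (L : ℝ) ^ 4)) * Zb) ^ (2 * a) * Zb ^ (1 - 2 * a) :=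
        mul_le_mul_left (ENNReal.rpow_le_rpow hdblE h2a.le) _
    _ = ENNReal.ofReal (Real.exp (A * (L : ℝ) ^ 4)) ^ (2 * a) * (Zb ^ (2 * a) * Zb ^ (1 - 2 * a)) := by
        rw [ENNReal.mul_rpow_of_nonneg _ _ h2a.le, mul_assoc]
    _ = ENNReal.ofReal (Real.exp (2 * a * A * (L : ℝ) ^ 4)) * Zb := by
        rw [← ENNReal.rpow_add _ _ hZb_pos hZb_top, show 2 * a + (1 - 2 * a) = 1 by ring, ENNReal.rpow_one,
          ENNReal.ofReal_rpow_of_nonneg (Real.exp_pos _).le h2a.le, ← Real.exp_mul]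
        congr 3
        ring

end Doubling

end Summit.QuantumFields.YangMills.BalabanUVNodes.N20LCSRestrictedDoubling

end
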